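import Summits.BirchSwinnertonDyer.Rank1Residual.X11b.KolyvaginH44OfEulerCongruence
import HarnessLib

/-!
# `h44` from Gross's Prop. 3.7 — the core theorem LOCALIZED to a set of levels `R`

Cell `b2b-bsdres`, team x11b3 (N8/O2), `h44` programme; lead GEN 9 ruling R10-16 (1) (DP1 (a):
the H37 bridge concludes the `h37` binder RESTRICTED to the divisors `m ∣ n` of ONE top level `n`).
HONEST FRAMING (cell, verbatim): published theorems only; nothing booked; Kolyvagin-chain hygiene,
NOT a discharge of `h44` or of `h37` (Gross 1991 Prop. 3.7 stays a LABELLED hypothesis; (γ) =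
Prop. 3.7 (2) cite-only); nothing `p = 3`-specific; JET@p∣N untouched; O2 OPEN / N8 CONSTRUCTION.
Theorems only — no definition, no named fact.

## Why this file exists (END re-read, x11b3-p2 GEN 7)

`KolyvaginH44.h44_of_prop37_of_ringClassDecomposition` (`X11b/KolyvaginH44OfEulerCongruence`) —
the only consumer of `h37` in the END chain `h44_of_prop37` ← `h44_of_prop37_of_totallyRamified` ←
`h44_of_prop37_of_ringClassField` ← `h44_of_prop37_of_ringClassDecomposition` — uses `h37` EXACTLY
ONCE, at the conclusion's own pair `(m, ℓ)` (`obtain ⟨hℓL, y', hy'P, hrel, hES⟩ := h37 m hm hkol ℓ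
hℓp hℓm`), and likewise `hsplit m`, `hram m` (and `hI (m/ℓ)`, `hA (m/ℓ)`, `hPt (m/ℓ)`).  The proof is
therefore POINTWISE in the level, but the STATEMENT carries `h37`, `hsplit`, `hram` as GLOBAL
`∀ m` binders outside the `∀ m` conclusion: a consumer holding Gross's Prop. 3.7 only for the
divisors of one square-free top level `n` (the coherent concrete Heegner data of
`RingClassTower.exists_coherent_kolyvaginHeegnerData`) cannot instantiate it.  This file re-types
the SAME theorem with a GUARD PREDICATE `R : ℕ → Prop` on the level — inserted as `∀ m : ℕ, R m →
Squarefree m → …` in `h37`, `hsplit`, `hram` AND in the conclusion, every other byte identical —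
and re-runs the SAME proof with the guard threaded (`R := fun _ ↦ True` recovers the original,
`R := (· ∣ n)` is the divisors-of-`n` form the bridge meets, `R := (· = m₀)` the pointwise form).

* **`h44_of_prop37_of_ringClassDecomposition_on`** — McCallum 1991, Prop. 4.4 at `λ ∣ m` in order
  form (the `h44` clause of `GrossBadPlace.exists_leafA_of_points_of_GZ31`) at every level `m` with
  `R m`, from `h37` (Gross Prop. 3.7 (1)(2) + inter-level lift), `hsplit`, `hram` ASSUMED ONLY AT
  THE LEVELS `m` WITH `R m`; proof = the tree's (`exists_reductionDatum`,
  `zsmul_kolyvaginClass_mem_selmerLocalKer_iff_of_isKolyvaginPrime`, `exists_root_of_relation`,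
  Gross (3.1)/(3.3)) verbatim.

The ring-class-field END with the Galois dictionary, localized the same way, is the sequel
`X11b/KolyvaginH44Localized` (`h44_of_prop37_on`, `h44_of_prop37_of_dvd`).

## References
* [GrossLMS1991] B. H. Gross, *Kolyvagin's work on modular elliptic curves*, LMS LNS 153 (1991):
  §3 (3.1)–(3.5), Prop. 3.7 (held `book:editornd-l-functions-arithmetic`, PDF p. 217 L19–22, proof
  p. 218 L1), Prop. 6.2 (2) and proof (PDF pp. 222–223).
* [McCallumLMS1991] W. G. McCallum, *Kolyvagin's work on Shafarevich–Tate groups*, ibid.: §4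
  (PDF p. 282 L1), Lemma 4.3, Prop. 4.4 and proof (PDF pp. 282–283).
-/

noncomputable section

open scoped Classical Pointwise
open WeierstrassCurve Field NumberField IsDedekindDomain Finset
open Literature.NumberTheory.EllipticCurves Literature.NumberTheory.GaloisRepresentations
open Literature.NumberTheory.EllipticCurves.KolyvaginCocycle
open Literature.NumberTheory.EllipticCurves.KolyvaginEuler
open Rat.HeightOneSpectrum

universe u

namespace Summit.BirchSwinnertonDyer.Rank1Residual.X11b.KolyvaginH44

variable {K : Type u} [Field K] [NumberField K]

/-! ## `h44` from Prop. 3.7 and the ring-class decomposition at `λ`, at the levels `R` -/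

/-- **McCallum 1991, Prop. 4.4 at `λ ∣ m` (the `h44` clause of
`GrossBadPlace.exists_leafA_of_points_of_GZ31`) from Gross's Prop. 3.7 and the ring-class
decomposition at `λ`, for a globally minimal `E/ℚ` — LOCALIZED to the levels `m` with `R m`.**
This is `h44_of_prop37_of_ringClassDecomposition` VERBATIM except that the three labelled
hypotheses `h37` (Gross 1991, Prop. 3.7 (1) *"`Tr_ℓ y_n = a_ℓ · y_m` in `E(K_m)`"* and (2) *"`y_n ≡
Frob(λ_m)(y_m) (mod λ_n)`"* with the inter-level lift `y'`), `hsplit` (*"`λ` splits completely in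
`K_m`"*) and `hram` (*"each prime factor of `l` in `K_m` ramifies totally in `K_n`"*, `G_ℓ = ⟨σ_ℓ⟩`)
are assumed ONLY at the levels `m` with `R m` (guard `∀ m : ℕ, R m → Squarefree m → …`), and the
conclusion is drawn at exactly those levels.  The tree's proof uses each of them once, at the
conclusion's own `(m, ℓ)`, so it runs unchanged with the guard threaded.  Instances: `R := (· ∣ n)`
(divisors of one top level — the form the H37 bridge supplies, lead R10-16 DP1 (a)), `R := fun _ ↦
True` (the original), `R := (· = m₀)` (pointwise).  HONEST FRAMING: Kolyvagin-chain hygiene; `h37`,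
`hsplit`, `hram` remain LABELLED cite-only hypotheses in Gross's / McCallum's wording, NOT facts, NOT
discharged here; nothing `p = 3`-specific; JET@p∣N untouched; nothing booked.
[cite: McCallumLMS1991, Prop. 4.4, Lemma 4.3, §4 (p. 282 l. 1)] [cite: GrossLMS1991, Prop. 3.7,
Prop. 6.2 (2), §3 (3.1)–(3.4)] -/
theorem h44_of_prop37_of_ringClassDecomposition_on {N : ℕ} [NeZero N] {W : WeierstrassCurve ℚ}
    [W.IsElliptic] [W.IsGloballyMinimal] (hK : IsImaginaryQuadratic K)
    {P : (W.baseChange K).toAffine.Point} (hHP : IsHeegnerPoint N W K P)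
    {p M : ℕ} (hp : p.Prime) (hp2 : p ≠ 2) (hM : 1 ≤ M) (hW : W.exists_weilPairing p)
    (hdiv : ∀ Q : geomPoints (W.baseChange K), ∃ R, ((p ^ M : ℕ) : ℤ) • R = Q)
    {𝒢 : ℕ → Type*} [∀ m, CommGroup (𝒢 m)] {A₀ : ℕ → Type*} [∀ m, AddCommGroup (A₀ m)]
    [∀ m, DistribMulAction (𝒢 m) (A₀ m)]
    (σ : ∀ m, ℕ → 𝒢 m) (L : ℕ → Finset ℕ) (H : ∀ m, Subgroup (𝒢 m))
    [∀ m, Fintype (𝒢 m ⧸ H m)] (f : ∀ m, 𝒢 m ⧸ H m → 𝒢 m)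
    (hord : ∀ m, ∀ ℓ ∈ L m, σ m ℓ ^ (ℓ + 1) = 1)
    (y : ∀ m, A₀ m)
    (π : ∀ m, absoluteGaloisGroup K →* 𝒢 m) (j : ∀ m, A₀ m →+ geomPoints (W.baseChange K))
    (hj : ∀ m (g : absoluteGaloisGroup K) (a : A₀ m), j m (π m g • a) = g • j m a)
    (hA : ∀ m, IsAdmissible (absoluteGaloisGroup K) (j m).range ((p ^ M : ℕ) : ℤ))
    (hPt : ∀ m, j m (kolyvaginPoint (σ m) (L m) (f m) (y m)) ∈
      invPoints (absoluteGaloisGroup K) (j m).range ((p ^ M : ℕ) : ℤ))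
    (hI : ∀ m : ℕ, ∀ v : HeightOneSpectrum (𝓞 K), (m : 𝓞 K) ∉ v.asIdeal →
      ∀ 𝔐 ∈ v.localPrimesAbove, ∀ t ∈ 𝔐.inertia (absoluteGaloisGroup (v.adicCompletion K)),
        resGal (K := K) (v.adicCompletion K) t • j m (kolyvaginPoint (σ m) (L m) (f m) (y m)) =
          j m (kolyvaginPoint (σ m) (L m) (f m) (y m)))
    (R : ℕ → Prop)
    (h37 : ∀ m : ℕ, R m → Squarefree m →
      (∀ q ∈ m.primeFactors, IsKolyvaginPrime N W K p q ∧ FrobEqFrobInfty W K (p ^ M) q) →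
      ∀ ℓ : ℕ, ℓ.Prime → ℓ ∣ m →
      ℓ ∈ L m ∧ ∃ y' : A₀ m,
        j m (kolyvaginPoint (σ m) ((L m).erase ℓ) (f m) y') =
          j (m / ℓ) (kolyvaginPoint (σ (m / ℓ)) (L (m / ℓ)) (f (m / ℓ)) (y (m / ℓ))) ∧
        grAct (A₀ m) (traceElt (σ m ℓ) ℓ) (y m) = W.frobeniusTrace ℓ • y' ∧
        ∀ [Fact ℓ.Prime] (hΔ : ¬ (ℓ : ℤ) ∣ minimalDiscriminantInt W)
          (φ₀ : absoluteGaloisGroup (ZMod ℓ)), (∀ x : AlgebraicClosure (ZMod ℓ), φ₀ • x = x ^ ℓ) →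
          ∀ γ : 𝒢 m, geomReduction hΔ ((RatClosure.pointsEquiv (K := K) W).symm (j m (γ • y m))) =
            φ₀ • geomReduction hΔ ((RatClosure.pointsEquiv (K := K) W).symm (j m (γ • y'))))
    (hsplit : ∀ m : ℕ, R m → Squarefree m →
      (∀ q ∈ m.primeFactors, IsKolyvaginPrime N W K p q ∧ FrobEqFrobInfty W K (p ^ M) q) →
      ∀ ℓ : ℕ, ℓ.Prime → ℓ ∣ m → ∀ v : HeightOneSpectrum (𝓞 K), (ℓ : 𝓞 K) ∈ v.asIdeal →
      ∀ 𝔓 ∈ v.primesAbove, ∀ F : absoluteGaloisGroup K, IsArithFrobAt (𝓞 K) F 𝔓 →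
        F • j (m / ℓ) (kolyvaginPoint (σ (m / ℓ)) (L (m / ℓ)) (f (m / ℓ)) (y (m / ℓ))) =
          j (m / ℓ) (kolyvaginPoint (σ (m / ℓ)) (L (m / ℓ)) (f (m / ℓ)) (y (m / ℓ))))
    (hram : ∀ m : ℕ, R m → Squarefree m →
      (∀ q ∈ m.primeFactors, IsKolyvaginPrime N W K p q ∧ FrobEqFrobInfty W K (p ^ M) q) →
      ∀ ℓ : ℕ, ℓ.Prime → ℓ ∣ m → ∀ v : HeightOneSpectrum (𝓞 K), (ℓ : 𝓞 K) ∈ v.asIdeal →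
      ∀ 𝔓 ∈ v.primesAbove, ∃ τ₀ ∈ 𝔓.inertia (absoluteGaloisGroup K), π m τ₀ = σ m ℓ ∧
        ∀ τ ∈ 𝔓.inertia (absoluteGaloisGroup K), ∃ i : ℕ, ∀ x ∈ (j m).range,
          τ • x = (τ₀ ^ i) • x) :
    ∀ m : ℕ, R m → Squarefree m →
      (∀ q ∈ m.primeFactors, IsKolyvaginPrime N W K p q ∧ FrobEqFrobInfty W K (p ^ M) q) →
      ∀ ℓ : ℕ, ℓ.Prime → ℓ ∣ m → ∀ v : HeightOneSpectrum (𝓞 K), (ℓ : 𝓞 K) ∈ v.asIdeal →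
        ∀ a : ℕ, (((p : ℤ) ^ a) • kolyvaginClass (W.baseChange K) _ hdiv (hA m)
              (j m (kolyvaginPoint (σ m) (L m) (f m) (y m))) (hPt m) ∈
            selmerLocalKer (W.baseChange K) (v.adicCompletion K) ((p ^ M : ℕ) : ℤ) ↔
          ((p : ℤ) ^ a) • kolyvaginClass (W.baseChange K) _ hdiv (hA (m / ℓ))
              (j (m / ℓ) (kolyvaginPoint (σ (m / ℓ)) (L (m / ℓ)) (f (m / ℓ)) (y (m / ℓ))))
              (hPt (m / ℓ)) ∈
            (W.baseChange K).torsionLocalKer (v.adicCompletion K) ((p ^ M : ℕ) : ℤ)) := by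
  intro m hRm hm hkol ℓ hℓp hℓm v hv a
  have hm0 : m ≠ 0 := Squarefree.ne_zero hm
  have hℓmem : ℓ ∈ m.primeFactors := Nat.mem_primeFactors.mpr ⟨hℓp, hℓm, hm0⟩
  obtain ⟨hℓ, hℓM⟩ := hkol ℓ hℓmem
  haveI : Fact ℓ.Prime := ⟨hℓp⟩
  haveI : Fact p.Prime := ⟨hp⟩
  have hvpl : v = hℓ.place := hℓ.mem_iff.mp hv
  have hpℓ : p ≠ ℓ := fun h ↦ hℓ.2.2.2.1 h.symm
  have hℓpM : ¬ ℓ ∣ p ^ M := fun h ↦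
    hpℓ ((Nat.prime_dvd_prime_iff_eq hℓp hp).mp (hℓp.dvd_of_dvd_pow h)).symm
  have hpM0 : p ^ M ≠ 0 := pow_ne_zero M hp.ne_zero
  -- good reduction at `λ` and at the place `v₀ = (ℓ)` of `ℚ`; `ℓ ∤ Δ_W`
  have hgood : (W.baseChange K).HasGoodReductionAt v := by
    have h := hℓ.not_mem_badPlaces hHP
    rw [mem_badPlaces_iff, not_not] at h
    rwa [hvpl]
  obtain ⟨v₀, hv₀, hℓv₀⟩ := exists_ratPlace ℓ
  have hgood₀ : W.HasGoodReductionAt v₀ := hℓ.hasGoodReductionAt_rat hHP v₀ hℓv₀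
  have hΔ : ¬ (ℓ : ℤ) ∣ minimalDiscriminantInt W := by
    have h1 := (hasGoodReductionAtPrime_iff_hasGoodReductionAt_ringOfIntegers v₀ W).mpr hgood₀
    have h2 := @not_dvd_minimalDiscriminantInt_of_hasGoodReductionAtPrime' W _
      (primesEquiv v₀ : ℕ) (Fact.mk (primesEquiv v₀).2) h1
    rwa [hv₀] at h2
  -- `p^M ∣ ℓ + 1`, `p^M ∣ a_ℓ`
  obtain ⟨-, l', hl'⟩ := IsKolyvaginPrime.pow_dvd_add_one W hp hℓ hM hℓM
  have haℓ : ((p : ℤ) ^ M) ∣ W.frobeniusTrace ℓ := by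
    have h := IsKolyvaginPrime.pow_dvd_frobeniusTraceAt W hp hHP hℓ hM hℓM hℓv₀
    rw [frobeniusTraceAt_eq_frobeniusTrace W v₀] at h
    rwa [show ((primesEquiv v₀ : ℕ)) = ℓ from hv₀] at h
  obtain ⟨a', ha'⟩ := haℓ
  have hpl : p ∣ ℓ + 1 := by
    have : (p : ℤ) ∣ ((ℓ + 1 : ℕ) : ℤ) := by
      rw [hl']; exact Dvd.dvd.mul_right (dvd_pow_self (p : ℤ) (by omega)) l'
    exact_mod_cast this
  have hpa : (p : ℤ) ∣ W.frobeniusTrace ℓ := by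
    rw [ha']; exact Dvd.dvd.mul_right (dvd_pow_self (p : ℤ) (by omega)) a'
  -- the inert place: uniqueness and `q_λ = ℓ²`
  have huniq : ∀ w : HeightOneSpectrum (𝓞 K), (ℓ : 𝓞 K) ∈ w.asIdeal → w = v :=
    fun w hw ↦ (hℓ.mem_iff.mp hw).trans hvpl.symm
  have hres : v.residueCard = ℓ ^ 2 := by rw [hvpl]; exact residueCard_place_eq_sq hK hℓ
  -- the Frobenius of `𝔽̄_ℓ`
  obtain ⟨φ₀, hφ₀'⟩ := exists_frobenius_absoluteGaloisGroup (ZMod ℓ)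
  have hφ₀ : ∀ x : AlgebraicClosure (ZMod ℓ), φ₀ • x = x ^ ℓ := fun x ↦ by
    rw [hφ₀' x, Nat.card_zmod]
  -- Prop. 3.7 at `(m, ℓ)` and the inter-level lift
  obtain ⟨hℓL, y', hy'P, hrel, hES⟩ := h37 m hRm hm hkol ℓ hℓp hℓm
  -- the Selmer condition of `c_M(m/ℓ)` at the good place `λ ∤ m/ℓ` (McCallum Lemma 4.3)
  have hmv : ((m / ℓ : ℕ) : 𝓞 K) ∉ v.asIdeal := by
    intro h
    rw [hvpl] at h
    have hdvd := dvd_of_natCast_mem_place hℓ hv₀ hℓv₀ h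
    have : ℓ * ℓ ∣ m := by
      have := Nat.mul_dvd_mul_left ℓ hdvd
      rwa [Nat.mul_div_cancel' hℓm] at this
    exact hℓp.one_lt.ne' (Nat.isUnit_iff.mp (hm ℓ this))
  obtain ⟨𝔐, h𝔐⟩ := v.localPrimesAbove_nonempty
  have hsel₂ := Three.GrossBadPlace.kolyvaginClass_mem_selmerLocalKer_of_inertia_of_hasGoodReductionAt
    (W.baseChange K)
    (hdiv := hdiv) (hA (m / ℓ)) (hPt (m / ℓ)) v hgood h𝔐 (hI (m / ℓ) v hmv 𝔐 h𝔐)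
  -- McCallum Prop. 4.4 in order form, from the reduction datum
  refine zsmul_kolyvaginClass_mem_selmerLocalKer_iff_of_isKolyvaginPrime W hK hp hp2 hℓ hℓM hv
    hgood (hA m) (hA (m / ℓ)) (hPt m) (hPt (m / ℓ)) hsel₂ (a := W.frobeniusTrace ℓ) hl' ha' ?_ _
  intro 𝔓 h𝔓 F hF hFfix
  refine ⟨hsplit m hRm hm hkol ℓ hℓp hℓm v hv 𝔓 h𝔓 F hF, ?_⟩
  obtain ⟨g, red, φ, hredg, hφ, hredI, hredF, hred, hBn, htors, hchar, hcyc⟩ :=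
    exists_reductionDatum W hΔ hp2 hpℓ hW hpl hpa hℓ.2.2.2.2.2 hφ₀ hv huniq hres h𝔓 hℓpM hpM0 hF
      hFfix
  obtain ⟨τ₀, hτ₀I, hπτ₀, hIτ₀⟩ := hram m hRm hm hkol ℓ hℓp hℓm v hv 𝔓 h𝔓
  -- Prop. 3.7 (2) for the reduction along `𝔓`
  have hES' : ∀ γ : 𝒢 m, red (j m (γ • y m)) = φ (red (j m (γ • y'))) := by
    intro γ
    rw [hredg, hredg, hφ, ← hj, ← hj, ← mul_smul, ← mul_smul]
    exact hES hΔ φ₀ hφ₀ _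
  -- the Euler-system root at `λ`
  have hlZ : ((ℓ + 1 : ℕ) : ℤ) = ((p ^ M : ℕ) : ℤ) * l' := by rw [hl']; push_cast; ring
  have haZ : W.frobeniusTrace ℓ = ((p ^ M : ℕ) : ℤ) * a' := by rw [ha']; push_cast; ring
  obtain ⟨R₀, hR₀A, hR₀, hR₀red⟩ := exists_root_of_relation (π m) (j m) (hj m) hℓL
    (hord m ℓ hℓL) (f m) hrel hlZ haZ hπτ₀ red φ hES'
  rw [hy'P] at hR₀red
  -- lift `B = Ẽ(𝔽̄_ℓ)` to the universe of `K`
  set e : ULift.{u} (reductionModPrime W ℓ).geomPoints ≃+ (reductionModPrime W ℓ).geomPoints :=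
    AddEquiv.ulift with he
  set redL : geomPoints (W.baseChange K) →+ ULift.{u} (reductionModPrime W ℓ).geomPoints :=
    e.symm.toAddMonoidHom.comp red with hredLdef
  set φL : ULift.{u} (reductionModPrime W ℓ).geomPoints →+
      ULift.{u} (reductionModPrime W ℓ).geomPoints :=
    e.symm.toAddMonoidHom.comp (φ.comp e.toAddMonoidHom) with hφLdef
  have hredL : ∀ x, redL x = e.symm (red x) := fun _ ↦ rfl
  have hφL : ∀ b, φL b = e.symm (φ (e b)) := fun _ ↦ rfl
  refine ⟨ULift.{u} (reductionModPrime W ℓ).geomPoints, inferInstance, redL, φL, τ₀, R₀, ?_, ?_, ?_,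
    ?_, ?_, ?_, ?_, hτ₀I, hIτ₀, hR₀A, hR₀, ?_⟩
  · intro τ hτ x
    rw [hredL, hredL, hredI τ hτ x]
  · intro x
    rw [hredL, hφL, hφL, hredL, AddEquiv.apply_symm_apply, AddEquiv.apply_symm_apply, hredF x]
  · intro x hx h0
    rw [hredL, AddEquiv.map_eq_zero_iff] at h0
    exact hred x hx h0
  · intro b hb
    have hb' : (((p ^ M : ℕ) : ℤ)) • e b = 0 := by rw [← map_zsmul, hb, map_zero]
    rw [hφL, hφL, AddEquiv.apply_symm_apply, hBn _ hb', AddEquiv.symm_apply_apply]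
  · intro b hb
    have hb' : φ (φ (e b)) = e b := by
      have := congrArg e hb
      rwa [hφL, hφL, AddEquiv.apply_symm_apply, AddEquiv.apply_symm_apply] at this
    have h := e.symm.toAddMonoidHom.isOfFinAddOrder (htors _ hb')
    rwa [AddEquiv.coe_toAddMonoidHom, AddEquiv.symm_apply_apply] at h
  · intro b hb
    have hb' : φ (φ (e b)) = e b := by
      have := congrArg e hb
      rwa [hφL, hφL, AddEquiv.apply_symm_apply, AddEquiv.apply_symm_apply] at this
    apply e.injective
    rw [map_zsmul, map_zsmul, hφL, AddEquiv.apply_symm_apply]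
    exact hchar _ hb'
  · intro s hs
    obtain ⟨g₁, e₁, hg₁, hord₁, hdvd₁, hndvd₁, hgen₁⟩ := hcyc s hs
    refine ⟨e.symm g₁, e₁, ?_, ?_, hdvd₁, hndvd₁, fun c hc hck ↦ ?_⟩
    · rw [hφL, AddEquiv.apply_symm_apply, hg₁, map_zsmul]
    · rw [← hord₁]
      exact addOrderOf_injective e.symm.toAddMonoidHom e.symm.injective g₁
    · have hc' : φ (e c) = s • e c := by
        have := congrArg e hc
        rwa [hφL, AddEquiv.apply_symm_apply, map_zsmul] at this
      obtain ⟨k, hk⟩ := hck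
      obtain ⟨i, hi⟩ := hgen₁ (e c) hc' ⟨k, by rw [← map_zsmul, hk, map_zero]⟩
      refine ⟨i, e.injective ?_⟩
      rw [hi, map_zsmul, AddEquiv.apply_symm_apply]
  · rw [hredL, hredL, hφL, AddEquiv.apply_symm_apply, hR₀red, map_sub, map_zsmul, map_zsmul]

end Summit.BirchSwinnertonDyer.Rank1Residual.X11b.KolyvaginH44

end
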